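import Summits.KontsevichZagierPeriods.Zeta5Search.Barrier.ConeGammaFarSliceKmin

/-!
# ζ(5) search — BARRIER: `C₀` TO FIRST ORDER IN THE FAR CHART — soundness IIb: `K_c(X_c, ·) ≥ kmin` on `Z`

HONEST FRAMING (cell `pub-zeta5`): systematic search; no irrationality claim unless kernel-certified. Theorems only. MODEL
objects under Brown–Zudilin's (28)+(30) ((28) observed, not proved): the resolved `Y`-part `K = H/z` of cert-2 g39's value
function in cert-2 g38's far chart (`FarSlice.valH`, `valK`) and the checker's `quadNonnegOn`, `kPieceGen`, `kPieceLo`, `kMin`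
(`ConeGammaFarSliceCheck`). Nothing here is a statement about the size of any critical value of record, any γ, the cone's
supremum (C2 OPEN), S-E (CONJECTURED), (TD_A) or `ζ(5)`; no number of record moves; records in print UNMOVED. Theory seat cert-2 g40
(item «C₀ TO FIRST ORDER IN THE FAR CHART — THE CENTRE-SLICE CERTIFICATE», part 3b′).

* `valH_zero`, `etaL_zero` — `H(0) = 0`, `η(0) = 0` (`xlnx(±1) = ∓1`, `Σσ_kβ′_k = 0`, `log 1 = 0`);
* `quadNonnegOn_sound` — a quadratic checked at the endpoints (and at an interior vertex when convex) is `≥ 0` on the interval;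
* `model_upper` / `model_lower` — the verified second-order model gives `κ ≤ H/z` on either side of `0`;
* **`kPieceLo_sound`**, `pairs_ok`, `exists_pair`, `kMin_le`, **`kMin_sound`** — `K_c(X_c, z) ≥ kmin` for every `z ≠ 0` of `Z`.
-/

open Finset Set
open Literature.Analysis.ValidatedNumerics.NumericsMP

namespace Summit.KontsevichZagierPeriods.Zeta5Search.Barrier.ConeGamma

namespace FarSlice

open LemmaFBox (SC SC_pos coef featVal minNum maxNum box centre centre_mem minNum_add_maxNum)
open Envelope (EForm formVal vforms valF valueV)

/-! ### `H(0) = 0`, `η(0) = 0`, the quadratic test, and `K` from below on one piece -/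

/-- `H(s, X, 0) = 0` for the eight `Y`-forms (`xlnx(±1) = ∓1` and `Σ σ_k β′_k = 0`). -/
theorem valH_zero (s : Fin 8 → ℝ) (X : ℝ) : valHL kforms s X 0 = 0 := by
  simp only [valHL, kforms, List.map_cons, List.map_nil, List.sum_cons, List.sum_nil, zero_mul, add_zero]
  simp [xlnx]

/-- `η(s, X, 0) = 0` for the eight `Y`-forms (`log|±1| = 0`). -/
theorem etaL_zero (s : Fin 8 → ℝ) (X : ℝ) : etaL kforms s X 0 = 0 := by
  simp only [etaL, kforms, List.map_cons, List.map_nil, List.sum_cons, List.sum_nil, zero_mul, add_zero]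
  simp

/-- **A quadratic checked by `quadNonnegOn` is `≥ 0` on the interval** (endpoint values; for a convex quadratic with an
interior vertex, the vertex value). -/
theorem quadNonnegOn_sound {A B C a b : ℚ} (h : quadNonnegOn A B C a b = true) {z : ℝ} (hza : (a : ℝ) ≤ z) (hzb : z ≤ (b : ℝ)) :
    0 ≤ (A : ℝ) * z * z + (B : ℝ) * z + (C : ℝ) := by
  unfold quadNonnegOn at h
  simp only [Bool.and_eq_true, Bool.or_eq_true, decide_eq_true_eq] at h
  obtain ⟨⟨ha0, hb0⟩, hv⟩ := h
  have ha0' : (0 : ℝ) ≤ (A : ℝ) * a * a + (B : ℝ) * a + C := by exact_mod_cast ha0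
  have hb0' : (0 : ℝ) ≤ (A : ℝ) * b * b + (B : ℝ) * b + C := by exact_mod_cast hb0
  rcases hv with ((hA | hva) | hvb) | hvv
  · -- concave: above the chord, and the chord is ≥ 0
    have hA' : (A : ℝ) ≤ 0 := by exact_mod_cast hA
    -- `q(z) − [(b−z) q(a) + (z−a) q(b)]/(b−a) = −A (z−a)(b−z) ≥ 0`
    rcases eq_or_lt_of_le (hza.trans hzb) with hab | hab
    · -- a = b
      have : z = a := le_antisymm (by rw [hab]; exact hzb) hza
      rw [this]; exact ha0'
    · have key : ((A : ℝ) * z * z + (B : ℝ) * z + C) * ((b : ℝ) - a)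
          = ((b : ℝ) - z) * ((A : ℝ) * a * a + (B : ℝ) * a + C) + (z - a) * ((A : ℝ) * b * b + (B : ℝ) * b + C)
            + (-(A : ℝ)) * (z - a) * ((b : ℝ) - z) * ((b : ℝ) - a) := by ring
      have hpos : (0 : ℝ) < (b : ℝ) - a := by linarith
      have : 0 ≤ ((A : ℝ) * z * z + (B : ℝ) * z + C) * ((b : ℝ) - a) := by
        rw [key]
        have t1 : 0 ≤ ((b : ℝ) - z) * ((A : ℝ) * a * a + (B : ℝ) * a + C) := mul_nonneg (by linarith) ha0'
        have t2 : 0 ≤ (z - a) * ((A : ℝ) * b * b + (B : ℝ) * b + C) := mul_nonneg (by linarith) hb0'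
        have t3 : 0 ≤ (-(A : ℝ)) * (z - a) * ((b : ℝ) - z) * ((b : ℝ) - a) :=
          mul_nonneg (mul_nonneg (mul_nonneg (by linarith) (by linarith)) (by linarith)) hpos.le
        linarith
      by_contra hc
      push Not at hc
      have := mul_neg_of_neg_of_pos hc hpos
      linarith
  · -- vertex left of `a`: `q(z) − q(a) = (z − a)(A(z + a) + B) ≥ 0`
    have hva' : -(B : ℝ) ≤ 2 * A * a := by exact_mod_cast hva
    by_cases hA : (A : ℝ) ≤ 0
    · -- concave case again (same chord argument)
      rcases eq_or_lt_of_le (hza.trans hzb) with hab | hab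
      · have : z = a := le_antisymm (by rw [hab]; exact hzb) hza
        rw [this]; exact ha0'
      · have key : ((A : ℝ) * z * z + (B : ℝ) * z + C) * ((b : ℝ) - a)
            = ((b : ℝ) - z) * ((A : ℝ) * a * a + (B : ℝ) * a + C) + (z - a) * ((A : ℝ) * b * b + (B : ℝ) * b + C)
              + (-(A : ℝ)) * (z - a) * ((b : ℝ) - z) * ((b : ℝ) - a) := by ring
        have hpos : (0 : ℝ) < (b : ℝ) - a := by linarith
        have t3 : 0 ≤ (-(A : ℝ)) * (z - a) * ((b : ℝ) - z) * ((b : ℝ) - a) :=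
          mul_nonneg (mul_nonneg (mul_nonneg (by linarith) (by linarith)) (by linarith)) hpos.le
        nlinarith [mul_nonneg (by linarith : (0:ℝ) ≤ (b : ℝ) - z) ha0', mul_nonneg (by linarith : (0:ℝ) ≤ z - a) hb0']
    · push Not at hA
      have e : (A : ℝ) * z * z + (B : ℝ) * z + C = ((A : ℝ) * a * a + (B : ℝ) * a + C) + (z - a) * ((A : ℝ) * (z + a) + B) := by
        ring
      rw [e]
      have : 0 ≤ (A : ℝ) * (z + a) + B := by nlinarith
      nlinarith [mul_nonneg (by linarith : (0:ℝ) ≤ z - a) this]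
  · -- vertex right of `b`: `q(z) − q(b) = (z − b)(A(z + b) + B) ≥ 0`
    have hvb' : 2 * (A : ℝ) * b ≤ -B := by exact_mod_cast hvb
    by_cases hA : (A : ℝ) ≤ 0
    · rcases eq_or_lt_of_le (hza.trans hzb) with hab | hab
      · have : z = a := le_antisymm (by rw [hab]; exact hzb) hza
        rw [this]; exact ha0'
      · have hpos : (0 : ℝ) < (b : ℝ) - a := by linarith
        have t3 : 0 ≤ (-(A : ℝ)) * (z - a) * ((b : ℝ) - z) * ((b : ℝ) - a) :=
          mul_nonneg (mul_nonneg (mul_nonneg (by linarith) (by linarith)) (by linarith)) hpos.le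
        have key : ((A : ℝ) * z * z + (B : ℝ) * z + C) * ((b : ℝ) - a)
            = ((b : ℝ) - z) * ((A : ℝ) * a * a + (B : ℝ) * a + C) + (z - a) * ((A : ℝ) * b * b + (B : ℝ) * b + C)
              + (-(A : ℝ)) * (z - a) * ((b : ℝ) - z) * ((b : ℝ) - a) := by ring
        nlinarith [mul_nonneg (by linarith : (0:ℝ) ≤ (b : ℝ) - z) ha0', mul_nonneg (by linarith : (0:ℝ) ≤ z - a) hb0']
    · push Not at hA
      have e : (A : ℝ) * z * z + (B : ℝ) * z + C = ((A : ℝ) * b * b + (B : ℝ) * b + C) + (z - b) * ((A : ℝ) * (z + b) + B) := by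
        ring
      rw [e]
      have : (A : ℝ) * (z + b) + B ≤ 0 := by nlinarith
      nlinarith [mul_nonneg_of_nonpos_of_nonpos (by linarith : z - (b : ℝ) ≤ 0) this]
  · -- vertex value `C − B²/(4A) ≥ 0`: then `q(z) = A (z + B/(2A))² + (C − B²/(4A)) ≥ 0` when `A > 0`
    have hvv' : (0 : ℝ) ≤ (C : ℝ) - (B : ℝ) * B / (4 * A) := by exact_mod_cast hvv
    by_cases hA : (A : ℝ) ≤ 0
    · rcases eq_or_lt_of_le (hza.trans hzb) with hab | hab
      · have : z = a := le_antisymm (by rw [hab]; exact hzb) hza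
        rw [this]; exact ha0'
      · have hpos : (0 : ℝ) < (b : ℝ) - a := by linarith
        have t3 : 0 ≤ (-(A : ℝ)) * (z - a) * ((b : ℝ) - z) * ((b : ℝ) - a) :=
          mul_nonneg (mul_nonneg (mul_nonneg (by linarith) (by linarith)) (by linarith)) hpos.le
        have key : ((A : ℝ) * z * z + (B : ℝ) * z + C) * ((b : ℝ) - a)
            = ((b : ℝ) - z) * ((A : ℝ) * a * a + (B : ℝ) * a + C) + (z - a) * ((A : ℝ) * b * b + (B : ℝ) * b + C)
              + (-(A : ℝ)) * (z - a) * ((b : ℝ) - z) * ((b : ℝ) - a) := by ring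
        nlinarith [mul_nonneg (by linarith : (0:ℝ) ≤ (b : ℝ) - z) ha0', mul_nonneg (by linarith : (0:ℝ) ≤ z - a) hb0']
    · push Not at hA
      have e : (A : ℝ) * z * z + (B : ℝ) * z + C = (A : ℝ) * (z + B / (2 * A)) ^ 2 + ((C : ℝ) - (B : ℝ) * B / (4 * A)) := by
        field_simp; ring
      rw [e]
      have : 0 ≤ (A : ℝ) * (z + B / (2 * A)) ^ 2 := mul_nonneg hA.le (sq_nonneg _)
      linarith

/-- The verified model gives `κ ≤ H/z` on the negative side: `H ≤ R(z)`, `κz − R(z) ≥ 0`, `z < 0`. -/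
theorem model_upper (h η lam a κ : ℚ) {z H : ℝ} (hstep : H ≤ (h : ℝ) + (z - a) * η + lam * (z - a) ^ 2)
    (hq : 0 ≤ ((-lam : ℚ) : ℝ) * z * z + ((κ - (η - 2 * lam * a) : ℚ) : ℝ) * z + ((-(h - η * a + lam * a * a) : ℚ) : ℝ))
    (hz : z < 0) : (κ : ℝ) ≤ H / z := by
  rw [le_div_iff_of_neg hz]
  push_cast at hq
  nlinarith [hstep, hq]

/-- The verified model gives `κ ≤ H/z` on the positive side: `R(z) ≤ H`, `R(z) − κz ≥ 0`, `z > 0`. -/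
theorem model_lower (h η lam a κ : ℚ) {z H : ℝ} (hstep : (h : ℝ) + (z - a) * η + lam * (z - a) ^ 2 ≤ H)
    (hq : 0 ≤ ((lam : ℚ) : ℝ) * z * z + ((η - 2 * lam * a - κ : ℚ) : ℝ) * z + ((h - η * a + lam * a * a : ℚ) : ℝ))
    (hz : 0 < z) : (κ : ℝ) ≤ H / z := by
  rw [le_div_iff₀ hz]
  push_cast at hq
  nlinarith [hstep, hq]

/-- **`K ≥ κ` on one z-piece.** With `kPieceLo … za zb = some κ`, no straddle of `0`, `za < zb`: for every `z` of the piece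
with `z ≠ 0`, `κ ≤ K_c(X_c, z)` at the centre direction `c` and the fixed abscissa. -/
theorem kPieceLo_sound {D T : ℕ} (hD : 0 < D) (hT : 0 < T) (lo hi : List ℕ) (xc : ℤ) {zden : ℕ} (hzden : 0 < zden)
    {za zb : ℤ} (hlt : za < zb) (hns : ¬ (za < 0 ∧ 0 < zb)) {κ : ℚ} (h : kPieceLo (2 * D * T) T lo hi xc zden za zb = some κ)
    {z : ℝ} (hz : z ∈ zSeg zden za zb) (hz0 : z ≠ 0) :
    (κ : ℝ) ≤ valK (centre D lo hi) ((xc : ℝ) / (2 * D * T)) z := by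
  set c := centre D lo hi with hc
  set X := (xc : ℝ) / (2 * D * T) with hX
  have hzd : (0 : ℝ) < zden := by exact_mod_cast hzden
  rw [valK, valH_eq_valHL]
  unfold kPieceLo at h
  by_cases ha0 : za = 0
  · -- piece `[0, zb]`: `H ≥ λ⁻ z²`, `K ≥ λ⁻ z ≥ min(λ⁻ b, 0)`
    rw [if_pos ha0] at h
    split at h
    swap
    · simp at h
    rename_i lam hlam
    simp only [Option.some.injEq] at h
    subst h
    have h0seg : (0 : ℝ) ∈ zSeg zden za zb := by
      refine ⟨by simp [ha0], ?_⟩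
      simp only [zero_mul]
      exact_mod_cast (by omega : (0 : ℤ) ≤ zb)
    have hb := (lamPiece_sound hD hT lo hi xc hzden h0seg hz false kforms hlam).2 rfl
    rw [valH_zero, etaL_zero] at hb
    simp only [sub_zero, mul_zero] at hb
    -- `z > 0`
    have hzpos : 0 < z := by
      rcases lt_or_gt_of_ne hz0 with hneg | hpos
      · exfalso; have := hz.1; rw [ha0] at this; push_cast at this; nlinarith
      · exact hpos
    have hzb : z ≤ (zb : ℝ) / zden := by rw [le_div_iff₀ hzd]; exact hz.2
    rw [le_div_iff₀ hzpos]
    push_cast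
    have : (min ((lam : ℝ) * ((zb : ℝ) / zden)) 0) * z ≤ (lam : ℝ) * z ^ 2 := by
      rcases le_or_gt 0 (lam : ℝ) with hl | hl
      · calc (min ((lam : ℝ) * ((zb : ℝ) / zden)) 0) * z ≤ 0 * z := mul_le_mul_of_nonneg_right (min_le_right _ _) hzpos.le
          _ ≤ (lam : ℝ) * z ^ 2 := by rw [zero_mul]; positivity
      · calc (min ((lam : ℝ) * ((zb : ℝ) / zden)) 0) * z ≤ ((lam : ℝ) * ((zb : ℝ) / zden)) * z :=
              mul_le_mul_of_nonneg_right (min_le_left _ _) hzpos.le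
          _ ≤ ((lam : ℝ) * z) * z := by
              apply mul_le_mul_of_nonneg_right _ hzpos.le
              exact mul_le_mul_of_nonpos_left hzb hl.le
          _ = (lam : ℝ) * z ^ 2 := by ring
    linarith
  rw [if_neg ha0] at h
  by_cases hb0 : zb = 0
  · -- piece `[za, 0]`: `H ≤ λ⁺ z²`, `K = H/z ≥ λ⁺ z ≥ min(λ⁺ a, 0)`
    rw [if_pos hb0] at h
    split at h
    swap
    · simp at h
    rename_i lam hlam
    simp only [Option.some.injEq] at h
    subst h
    have h0seg : (0 : ℝ) ∈ zSeg zden za zb := by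
      refine ⟨?_, by simp [hb0]⟩
      simp only [zero_mul]
      exact_mod_cast (by omega : za ≤ (0 : ℤ))
    have hb := (lamPiece_sound hD hT lo hi xc hzden h0seg hz true kforms hlam).1 rfl
    rw [valH_zero, etaL_zero] at hb
    simp only [sub_zero, mul_zero] at hb
    have hzneg : z < 0 := by
      rcases lt_or_gt_of_ne hz0 with hneg | hpos
      · exact hneg
      · exfalso; have := hz.2; rw [hb0] at this; push_cast at this; nlinarith
    have hza : (za : ℝ) / zden ≤ z := by rw [div_le_iff₀ hzd]; exact hz.1
    rw [le_div_iff_of_neg hzneg]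
    push_cast
    have : (lam : ℝ) * z ^ 2 ≤ (min ((lam : ℝ) * ((za : ℝ) / zden)) 0) * z := by
      rcases le_or_gt 0 (lam : ℝ) with hl | hl
      · -- λ ≥ 0: λ z² = (λ z) z with λ z ≤ λ a… both ≤ 0·z? use λ z ≥ λ·a? No: we need λ z² ≤ m z with z<0 ⇔ λ z ≥ m.
        have h1 : (min ((lam : ℝ) * ((za : ℝ) / zden)) 0) ≤ (lam : ℝ) * z :=
          (min_le_left _ _).trans (mul_le_mul_of_nonneg_left hza hl)
        nlinarith
      · have h1 : (min ((lam : ℝ) * ((za : ℝ) / zden)) 0) ≤ (lam : ℝ) * z := by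
          refine (min_le_right _ _).trans ?_
          exact le_of_lt (mul_pos_of_neg_of_neg hl hzneg)
        nlinarith
    linarith
  rw [if_neg hb0] at h
  -- general piece: second-order model from the base `za`, verified quadratic sign condition
  have haseg : ((za : ℝ) / zden) ∈ zSeg zden za zb := by
    refine ⟨by rw [div_mul_cancel₀ _ hzd.ne'], ?_⟩
    rw [div_mul_cancel₀ _ hzd.ne']; exact_mod_cast hlt.le
  have hS : (0 : ℝ) < SC := by exact_mod_cast SC_pos
  have hza : (za : ℝ) / zden ≤ z := by rw [div_le_iff₀ hzd]; exact hz.1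
  have hzb : z ≤ (zb : ℝ) / zden := by rw [le_div_iff₀ hzd]; exact hz.2
  have hza0 : 0 ≤ z - (za : ℝ) / zden := by linarith
  by_cases hup : zb < 0
  · rw [if_pos hup] at h
    unfold kPieceGen at h
    split at h
    swap
    · simp at h
    rename_i lam HI EI hlam hH hE
    simp only [if_true] at h
    split at h
    swap
    · simp at h
    rename_i hok
    simp only [Option.some.injEq] at h
    subst h
    have hHm := hAt_sound hD hT hzden kforms hH
    have hEm := etaAt_sound hD hT hzden kforms hE
    have hb := (lamPiece_sound hD hT lo hi xc hzden haseg hz true kforms hlam).1 rfl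
    have hH' := MI.le_hi_div SC_pos hHm
    have hE' := MI.le_hi_div SC_pos hEm
    have hzneg : z < 0 := by
      have : (zb : ℝ) < 0 := by exact_mod_cast hup
      have := hz.2; nlinarith
    have hq := quadNonnegOn_sound hok (by push_cast; exact hza) (by push_cast; exact hzb)
    have step : valHL kforms c X z ≤ (HI.hi : ℝ) / SC + (z - (za : ℝ) / zden) * ((EI.hi : ℝ) / SC)
        + (lam : ℝ) * (z - (za : ℝ) / zden) ^ 2 := by
      have := mul_le_mul_of_nonneg_left hE' hza0
      nlinarith [hb, hH', this]
    exact model_upper _ _ _ _ _ (by push_cast; exact step) hq hzneg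
  · rw [if_neg hup] at h
    unfold kPieceGen at h
    split at h
    swap
    · simp at h
    rename_i lam HI EI hlam hH hE
    simp only [Bool.false_eq_true, if_false] at h
    split at h
    swap
    · simp at h
    rename_i hok
    simp only [Option.some.injEq] at h
    subst h
    have hapos : 0 < za := by
      push Not at hup
      have hzb0 : 0 < zb := lt_of_le_of_ne hup (Ne.symm hb0)
      by_contra hcon; push Not at hcon
      exact hns ⟨lt_of_le_of_ne hcon ha0, hzb0⟩
    have hHm := hAt_sound hD hT hzden kforms hH
    have hEm := etaAt_sound hD hT hzden kforms hE
    have hb := (lamPiece_sound hD hT lo hi xc hzden haseg hz false kforms hlam).2 rfl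
    have hH' := MI.lo_div_le SC_pos hHm
    have hE' := MI.lo_div_le SC_pos hEm
    have hzpos : 0 < z := by
      have : (0 : ℝ) < za := by exact_mod_cast hapos
      have := hz.1; nlinarith
    have hq := quadNonnegOn_sound hok (by push_cast; exact hza) (by push_cast; exact hzb)
    have step : (HI.lo : ℝ) / SC + (z - (za : ℝ) / zden) * ((EI.lo : ℝ) / SC)
        + (lam : ℝ) * (z - (za : ℝ) / zden) ^ 2 ≤ valHL kforms c X z := by
      have := mul_le_mul_of_nonneg_left hE' hza0
      nlinarith [hb, hH', this]
    exact model_lower _ _ _ _ _ (by push_cast; exact step) hq hzpos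

/-! ### The pieces cover `Z`; `kMin` -/

/-- `zListOK` for a cons-cons. -/
theorem zListOK_cons_cons (a b : ℤ) (l : List ℤ) :
    zListOK (a :: b :: l) = (decide (a < b) && !(decide (a < 0) && decide (0 < b)) && zListOK (b :: l)) := rfl

/-- **Every consecutive pair of an OK breakpoint list is an ordered piece not straddling `0`.** -/
theorem pairs_ok : ∀ (L : List ℤ), zListOK L = true → ∀ p ∈ pairs L, p.1 < p.2 ∧ ¬ (p.1 < 0 ∧ 0 < p.2)
  | [], _ => by simp [pairs]
  | [_], _ => by simp [pairs]
  | a :: b :: l, h => by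
    rw [zListOK_cons_cons] at h
    simp only [Bool.and_eq_true, decide_eq_true_eq, Bool.not_eq_true', Bool.and_eq_false_iff,
      decide_eq_false_iff_not, not_lt] at h
    obtain ⟨⟨hab, hns⟩, hrest⟩ := h
    intro p hp
    simp only [pairs, List.mem_cons] at hp
    rcases hp with rfl | hp
    · refine ⟨hab, fun ⟨h1, h2⟩ => ?_⟩
      rcases hns with h | h
      · exact absurd h1 (not_lt.mpr h)
      · exact absurd h2 (not_lt.mpr h)
    · exact pairs_ok (b :: l) hrest p hp

/-- **The pieces cover the breakpoint range**: for `x` between the head and the last breakpoint of an OK list with at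
least two entries there is a consecutive pair around `x`. -/
theorem exists_pair : ∀ (a b : ℤ) (l : List ℤ), zListOK (a :: b :: l) = true → ∀ {x : ℝ}, (a : ℝ) ≤ x → x ≤ (zLast (a :: b :: l) : ℝ) →
    ∃ p ∈ pairs (a :: b :: l), (p.1 : ℝ) ≤ x ∧ x ≤ (p.2 : ℝ)
  | a, b, [], _, x, h1, h2 => ⟨(a, b), by simp [pairs], h1, by simpa [zLast] using h2⟩
  | a, b, c :: l, h, x, h1, h2 => by
    by_cases hxb : x ≤ (b : ℝ)
    · exact ⟨(a, b), by simp [pairs], h1, hxb⟩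
    · push Not at hxb
      rw [zListOK_cons_cons] at h
      simp only [Bool.and_eq_true] at h
      obtain ⟨_, hrest⟩ := h
      have h2' : x ≤ (zLast (b :: c :: l) : ℝ) := by simpa [zLast] using h2
      obtain ⟨p, hp, hp1, hp2⟩ := exists_pair b c l hrest hxb.le h2'
      exact ⟨p, List.mem_cons_of_mem _ hp, hp1, hp2⟩

/-- `zLast` of the breakpoint list is `zhi`. -/
theorem zLast_zList (fd : CritFar.FarData) (sd : SliceData) : zLast (zList fd sd) = fd.zhi := by
  unfold zList
  generalize fd.zlo = a
  induction sd.zcuts generalizing a with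
  | nil => rfl
  | cons b l ih => simp only [List.cons_append]; rw [show zLast (a :: b :: (l ++ [fd.zhi])) = zLast (b :: (l ++ [fd.zhi])) from rfl]; exact ih b

/-- **`kMin` bounds every piece**: `kMin … ps = some κ` gives `κ ≤ kPieceLo p` for every piece `p`. -/
theorem kMin_le : ∀ (ps : List (ℤ × ℤ)) {Q T : ℕ} {lo hi : List ℕ} {xc : ℤ} {zden : ℕ} {κ : ℚ},
    kMin Q T lo hi xc zden ps = some κ → ∀ p ∈ ps, ∃ κp : ℚ, kPieceLo Q T lo hi xc zden p.1 p.2 = some κp ∧ κ ≤ κp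
  | [], _, _, _, _, _, _, _, h => by simp [kMin] at h
  | [p], _, _, _, _, _, _, κ, h => by
    intro q hq
    simp only [List.mem_singleton] at hq
    subst hq
    simp only [kMin] at h
    exact ⟨κ, h, le_rfl⟩
  | p :: p' :: ps, _, _, _, _, _, _, κ, h => by
    simp only [kMin] at h
    split at h
    swap
    · simp at h
    rename_i a b ha hb
    simp only [Option.some.injEq] at h
    subst h
    intro q hq
    rcases List.mem_cons.mp hq with rfl | hq'
    · exact ⟨a, ha, min_le_left _ _⟩
    · obtain ⟨κp, h1, h2⟩ := kMin_le (p' :: ps) hb q hq'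
      exact ⟨κp, h1, (min_le_right _ _).trans h2⟩

/-- **`K_c(X_c, z) ≥ kmin` on the whole of `Z`** (every `z ≠ 0` with `zlo ≤ z·zden ≤ zhi`). -/
theorem kMin_sound {D T : ℕ} (hD : 0 < D) (hT : 0 < T) (lo hi : List ℕ) {fd : CritFar.FarData} (hzden : 0 < fd.zden)
    {sd : SliceData} (hok : zListOK (zList fd sd) = true) {κ : ℚ}
    (h : kMin (2 * D * T) T lo hi sd.xc fd.zden (pairs (zList fd sd)) = some κ) {z : ℝ}
    (hz : z ∈ zSeg fd.zden fd.zlo fd.zhi) (hz0 : z ≠ 0) :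
    (κ : ℝ) ≤ valK (centre D lo hi) ((sd.xc : ℝ) / (2 * D * T)) z := by
  -- the list has at least two entries
  have hshape : ∃ b l, zList fd sd = fd.zlo :: b :: l := by
    unfold zList
    cases sd.zcuts with
    | nil => exact ⟨fd.zhi, [], rfl⟩
    | cons b l => exact ⟨b, l ++ [fd.zhi], rfl⟩
  obtain ⟨b, l, hL⟩ := hshape
  have hlast : zLast (fd.zlo :: b :: l) = fd.zhi := by rw [← hL]; exact zLast_zList fd sd
  rw [hL] at hok h
  obtain ⟨p, hp, hp1, hp2⟩ := exists_pair fd.zlo b l hok hz.1 (by rw [hlast]; exact hz.2)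
  obtain ⟨κp, hκp, hle⟩ := kMin_le _ h p hp
  obtain ⟨hplt, hpns⟩ := pairs_ok _ hok p hp
  have := kPieceLo_sound hD hT lo hi sd.xc hzden hplt hpns hκp ⟨hp1, hp2⟩ hz0
  exact le_trans (by exact_mod_cast hle) this

end FarSlice

end Summit.KontsevichZagierPeriods.Zeta5Search.Barrier.ConeGamma
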